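import Literature.Probability.LatticeModels.CurrentsEdgeAvoidance
import HarnessLib

/-!
# Value cylinders of the finite-volume random currents and their infinite-volume limits

Topic `Probability/LatticeModels`, namespace `Literature.Probability.LatticeModels`; theorems and
plain definitions only. For the sourceless `+` and free random currents of the boxes `Λ_L ⊂ ℤ^d`
(ghost-free form of the tree: currents on `plusBoxGraph d L` / `freeBoxGraph d L` with no sources in
`Λ_L`, `DoubleCurrents.lean`, `PlusCurrents.lean`) we compute the probabilities of the **value
cylinders**

`P̂^#_{Λ_L,β}[n_e = 1 for e ∈ S₁, n_e = 0 for e ∈ S ∖ S₁]`  (`S₁ ⊆ S` finite sets of lattice bonds)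

and prove their convergence as `L → ∞`. This is the finite-dimensional input for the infinite-volume
(single and summed) random currents `P^+_{ℤ^d,β}`, `P^0 ⊗ P^+` of

* M. Aizenman, H. Duminil-Copin, V. Sidoravicius, Comm. Math. Phys. 334 (2015), Thm. 2.3 (R1) and
  its proof ("`P̂^#_{Λ_L,β}[𝒞_E] = Z^#(Λ_L∖E,β)/Z^#(Λ_L,β) ∏ cosh(βJ)` … the convergence follows from
  the convergence of correlation functions"; bib key `AizenmanDuminilCopinSidoraviciusCMP2015`), and
* A. Raoufi, Ann. Probab. 48 (2020), Thm. 2 ("there exist two measures `P⁰_{G,β}` and `P⁺_{G,β}` on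
  `Ω_G` such that `P⁰` is the weak limit of `P_{Λ_n,β}` and `P⁺` is the weak limit of `P_{Λ_n∪δ,β}`";
  bib key `Raoufi2020`),

in the value-level form needed for Raoufi's events (`n_{xy} = 1`). The mechanism is the one of
ADS15 (2.13)–(2.14), one step further than the avoidance probabilities of `CurrentsEdgeAvoidance.lean`:
writing `n = 𝟙_{S₁} + m` with `m ≡ 0` on `S`,

`∑_{∂n ∩ Λ = A, n = 𝟙_{S₁} on S} w_β(n) = β^{|S₁|} ∑_{∂m ∩ Λ = A ∆ ∂𝟙_{S₁}, m ≡ 0 on S} w_β(m)`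
(`plusCurrentSumVal_eq`), and `∑_{∂m ∩ Λ = B, m ≡ 0 on S} w_β(m) / ∑_{∂m ∩ Λ = ∅} w_β(m)
= ⟨σ_B e^{-βK_S}⟩⁺_Λ` (`plusCurrentSumAvoid_div_eq_isingExpect_spinProduct`, the sourced version of the
tree's `plusCurrentSumAvoid_div_eq_isingExpect`). Hence on `ℤ^d`

`P̂⁺_{Λ_L,β}[n = 𝟙_{S₁} on S] = β^{|S₁|} ⟨σ_{A(S₁)} e^{-βK_S}⟩⁺_{Λ_L;β,0}`,
`A(S₁) = ∂𝟙_{S₁}` = the sites covered an odd number of times by `S₁` (`bondsSupport`)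

(`plusCurrentValProb_eq_isingExpect`, `freeCurrentValProb_eq_isingExpect`), which is a finite
combination of correlations (`isingExpect_spinProduct_expNegBonds_eq_sum`) and converges by the
existence of the plus / free states (`tendsto_plusCurrentValProb`, `tendsto_freeCurrentValProb`).

## Mathlib status

No random currents in Mathlib. Anchors: `Function.Injective.tsum_eq`, `tsum_mul_left`,
`Finset.prod_filter_mul_prod_filter_not`, `inf_symmDiff_distrib_right`; tree: `plusCurrentSum`,
`plusCurrentSumAvoid`, `plusCurrentSumAvoid_eq`, `isingWeight_plus_eq_deleteEdges_mul`,
`sum_spinProduct_mul_prod_exp_glue_plus`, `boxBonds`, `sum_boxBonds_eq`, `expNegBonds_eq_sum`,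
`hasBoxLimit_isingCorr_plus_holds`, `hasBoxLimit_isingCorr_free_holds`.
-/

noncomputable section

open MeasureTheory Finset Filter Topology
open scoped symmDiff

namespace Literature.Probability.LatticeModels

/-! ### Value cylinders on a general finite graph -/

section General

variable {V : Type*} [Fintype V] [DecidableEq V] (G : SimpleGraph V) [DecidableRel G.Adj]

/-- The **unit current on `S₁ ∩ S`**: `𝟙_{S₁}` on the bonds of `S`, zero elsewhere. [folklore] -/
def unitCurrent (S S₁ : Finset (Sym2 V)) : Current G := fun e =>
  if (e : Sym2 V) ∈ S ∧ (e : Sym2 V) ∈ S₁ then 1 else 0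

/-- The generating sum of currents with sources `A` inside `Λ` **taking the values `𝟙_{S₁}` on the
bonds of `S`**: `∑_{∂n ∩ Λ = A, n_e = 𝟙[e ∈ S₁] (e ∈ S)} w_β(n)` (the numerator of the value cylinder
`P̂^#_Λ[n = 𝟙_{S₁} on S]`; ADS15 (2.13) is the case `S₁ = ∅`). [cite: AizenmanDuminilCopinSidoraviciusCMP2015, §2.2, eq. (2.13)] -/
def plusCurrentSumVal (Λ : Finset V) (β : ℝ) (S S₁ : Finset (Sym2 V)) (A : Finset V) : ℝ :=
  ∑' n : Current G, if n.sources ∩ Λ = A ∧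
    (∀ e : G.edgeFinset, (e : Sym2 V) ∈ S → n e = if (e : Sym2 V) ∈ S₁ then 1 else 0) then n.weight β else 0

/-- The summands of `plusCurrentSumVal` are summable. [folklore] -/
theorem summable_plusCurrentSumVal_term (Λ : Finset V) (β : ℝ) (S S₁ : Finset (Sym2 V)) (A : Finset V) :
    Summable fun n : Current G => if n.sources ∩ Λ = A ∧
      (∀ e : G.edgeFinset, (e : Sym2 V) ∈ S → n e = if (e : Sym2 V) ∈ S₁ then 1 else 0) then n.weight β else 0 :=
  (Current.summable_weight_abs G β).of_norm_bounded fun n => by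
    split_ifs
    · rw [Real.norm_eq_abs, Current.abs_weight]
    · rw [norm_zero]; exact Current.weight_nonneg (abs_nonneg β) n

/-- `plusCurrentSumVal ≥ 0` for `β ≥ 0`. [folklore] -/
theorem plusCurrentSumVal_nonneg (Λ : Finset V) {β : ℝ} (hβ : 0 ≤ β) (S S₁ : Finset (Sym2 V))
    (A : Finset V) : 0 ≤ plusCurrentSumVal G Λ β S S₁ A :=
  tsum_nonneg fun n => by
    split_ifs
    · exact Current.weight_nonneg hβ n
    · exact le_rfl

/-- In a Boolean algebra `x ∆ y = z ↔ y = z ∆ x` (symmetric difference is a group law). [folklore] -/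
theorem symmDiff_eq_iff_eq_symmDiff (x y z : Finset V) : x ∆ y = z ↔ y = z ∆ x := by
  constructor
  · rintro rfl
    rw [symmDiff_comm x y, symmDiff_assoc, symmDiff_self, symmDiff_bot]
  · rintro rfl
    rw [symmDiff_comm z x, ← symmDiff_assoc, symmDiff_self, bot_symmDiff]

/-- The weight of `𝟙_{S₁} + m` for `m ≡ 0` on `S`: `w_β(𝟙_{S₁} + m) = β^{|S₁ ∩ S ∩ E(G)|} w_β(m)`. [folklore] -/
theorem weight_unitCurrent_add {S S₁ : Finset (Sym2 V)} (β : ℝ) {m : Current G}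
    (hm : ∀ e : G.edgeFinset, (e : Sym2 V) ∈ S → m e = 0) :
    (unitCurrent G S S₁ + m).weight β =
      β ^ #(univ.filter fun e : G.edgeFinset => (e : Sym2 V) ∈ S ∧ (e : Sym2 V) ∈ S₁) * m.weight β := by
  unfold Current.weight
  set P : G.edgeFinset → Prop := fun e => (e : Sym2 V) ∈ S ∧ (e : Sym2 V) ∈ S₁ with hP
  rw [← prod_filter_mul_prod_filter_not univ P, ← prod_filter_mul_prod_filter_not univ P
    (f := fun e => β ^ m e / ((m e).factorial : ℝ))]
  have h1 : ∏ e ∈ univ.filter P, β ^ (unitCurrent G S S₁ + m) e / (((unitCurrent G S S₁ + m) e).factorial : ℝ) =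
      β ^ #(univ.filter P) := by
    rw [← prod_const]
    refine prod_congr rfl fun e he => ?_
    rw [mem_filter] at he
    have he2 : (e : Sym2 V) ∈ S ∧ (e : Sym2 V) ∈ S₁ := he.2
    simp [unitCurrent, he2, hm e he2.1]
  have h2 : ∏ e ∈ univ.filter P, β ^ m e / ((m e).factorial : ℝ) = 1 := by
    refine prod_eq_one fun e he => ?_
    rw [mem_filter] at he
    simp [hm e he.2.1]
  have h3 : ∏ e ∈ univ.filter (fun e => ¬P e), β ^ (unitCurrent G S S₁ + m) e / (((unitCurrent G S S₁ + m) e).factorial : ℝ) =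
      ∏ e ∈ univ.filter (fun e => ¬P e), β ^ m e / ((m e).factorial : ℝ) := by
    refine prod_congr rfl fun e he => ?_
    rw [mem_filter] at he
    have : unitCurrent G S S₁ e = 0 := by simp only [unitCurrent]; rw [if_neg he.2]
    simp [this]
  rw [h1, h2, h3, one_mul]

/-- **Splitting off the prescribed values** (the step `n = 𝟙_{S₁} + m`, `m ≡ 0 on S`):
`∑_{∂n ∩ Λ = A, n = 𝟙_{S₁} on S} w_β(n) = β^{|S ∩ S₁ ∩ E(G)|} ∑_{∂m ∩ Λ = A ∆ (∂𝟙_{S₁} ∩ Λ), m ≡ 0 on S} w_β(m)`. [cite: AizenmanDuminilCopinSidoraviciusCMP2015, §2.2, eqs. (2.13)–(2.14)] -/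
theorem plusCurrentSumVal_eq (Λ : Finset V) (β : ℝ) (S S₁ : Finset (Sym2 V)) (A : Finset V) :
    plusCurrentSumVal G Λ β S S₁ A =
      β ^ #(univ.filter fun e : G.edgeFinset => (e : Sym2 V) ∈ S ∧ (e : Sym2 V) ∈ S₁) *
        plusCurrentSumAvoid G Λ β S (A ∆ ((unitCurrent G S S₁).sources ∩ Λ)) := by
  set u : Current G := unitCurrent G S S₁ with hu
  set C : ℝ := β ^ #(univ.filter fun e : G.edgeFinset => (e : Sym2 V) ∈ S ∧ (e : Sym2 V) ∈ S₁) with hC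
  set f : Current G → ℝ := fun n => if n.sources ∩ Λ = A ∧
    (∀ e : G.edgeFinset, (e : Sym2 V) ∈ S → n e = if (e : Sym2 V) ∈ S₁ then 1 else 0) then n.weight β else 0
    with hf
  have hu_apply : ∀ e : G.edgeFinset, (e : Sym2 V) ∈ S → u e = if (e : Sym2 V) ∈ S₁ then 1 else 0 := by
    intro e he
    simp only [hu, unitCurrent]
    by_cases h1 : (e : Sym2 V) ∈ S₁
    · rw [if_pos ⟨he, h1⟩, if_pos h1]
    · rw [if_neg (fun h => h1 h.2), if_neg h1]
  have hu_zero : ∀ e : G.edgeFinset, (e : Sym2 V) ∉ S → u e = 0 := fun e he => by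
    simp only [hu, unitCurrent]; rw [if_neg (fun h => he h.1)]
  -- the summand at `u + m`
  have hfg : ∀ m : Current G, f (u + m) =
      if m.sources ∩ Λ = A ∆ (u.sources ∩ Λ) ∧ (∀ e : G.edgeFinset, (e : Sym2 V) ∈ S → m e = 0)
      then C * m.weight β else 0 := by
    intro m
    have hcond : (∀ e : G.edgeFinset, (e : Sym2 V) ∈ S → (u + m) e = if (e : Sym2 V) ∈ S₁ then 1 else 0) ↔
        ∀ e : G.edgeFinset, (e : Sym2 V) ∈ S → m e = 0 := by
      refine forall_congr' fun e => forall_congr' fun he => ?_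
      rw [Pi.add_apply, hu_apply e he]
      omega
    have hsrc : (u + m).sources ∩ Λ = A ↔ m.sources ∩ Λ = A ∆ (u.sources ∩ Λ) := by
      rw [Current.sources_add, show (u.sources ∆ m.sources) ∩ Λ = (u.sources ∩ Λ) ∆ (m.sources ∩ Λ) from
        inf_symmDiff_distrib_right _ _ _, symmDiff_eq_iff_eq_symmDiff]
    simp only [hf, hcond, hsrc]
    by_cases h : m.sources ∩ Λ = A ∆ (u.sources ∩ Λ) ∧ ∀ e : G.edgeFinset, (e : Sym2 V) ∈ S → m e = 0
    · rw [if_pos h, if_pos h, weight_unitCurrent_add G β h.2]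
    · rw [if_neg h, if_neg h]
  -- reindex the sum along `m ↦ u + m`
  have hinj : Function.Injective fun m : Current G => u + m := add_right_injective u
  have hsupp : Function.support f ⊆ Set.range fun m : Current G => u + m := by
    intro n hn
    have hcond : ∀ e : G.edgeFinset, (e : Sym2 V) ∈ S → n e = if (e : Sym2 V) ∈ S₁ then 1 else 0 := by
      by_contra h
      exact hn (if_neg fun h' => h h'.2)
    refine ⟨n - u, funext fun e => ?_⟩
    change u e + (n e - u e) = n e
    have hle : u e ≤ n e := by
      by_cases he : (e : Sym2 V) ∈ S
      · rw [hu_apply e he, hcond e he]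
      · rw [hu_zero e he]; exact Nat.zero_le _
    omega
  calc plusCurrentSumVal G Λ β S S₁ A = ∑' n, f n := rfl
    _ = ∑' m, f (u + m) := (hinj.tsum_eq hsupp).symm
    _ = ∑' m : Current G, C * (if m.sources ∩ Λ = A ∆ (u.sources ∩ Λ) ∧
          (∀ e : G.edgeFinset, (e : Sym2 V) ∈ S → m e = 0) then m.weight β else 0) := by
        refine tsum_congr fun m => ?_
        rw [hfg m]
        split_ifs <;> simp
    _ = C * plusCurrentSumAvoid G Λ β S (A ∆ (u.sources ∩ Λ)) := by
        rw [tsum_mul_left]; rfl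

/-- **ADS15 (2.13)–(2.14) with sources, ghost-free form**: if every edge of the finite graph `G`
touches `Λ`, `T ⊆ E(G)` and `B ⊆ Λ`, then for every real `β`,
`∑_{∂m ∩ Λ = B, m ≡ 0 on T} w_β(m) / ∑_{∂m ∩ Λ = ∅} w_β(m) = Z⁺_Λ(G∖T)(B)/Z⁺_Λ(G)(∅)
= ⟨σ_B exp(-β ∑_{e ∈ T} σ_e)⟩⁺_{Λ;β,0}`. The case `B = ∅` is the tree's
`plusCurrentSumAvoid_div_eq_isingExpect`. [cite: AizenmanDuminilCopinSidoraviciusCMP2015, §2.2, eqs. (2.13)–(2.14)] -/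
theorem plusCurrentSumAvoid_div_eq_isingExpect_spinProduct {Λ : Finset V}
    (hG : edgesTouching G Λ = G.edgeFinset) {T : Finset (Sym2 V)} (hT : T ⊆ G.edgeFinset) (β : ℝ)
    {B : Finset V} (hB : B ⊆ Λ) :
    plusCurrentSumAvoid G Λ β T B / plusCurrentSum G Λ β ∅ =
      isingExpect G Λ β 0 .plus
        (fun σ => spinProduct B σ * Real.exp (-β * ∑ e ∈ T, bondSpin σ e)) := by
  have hG' := edgesTouching_deleteEdges_eq G hG T
  have hf : Measurable fun σ : SpinConfig V => spinProduct B σ * Real.exp (-β * ∑ e ∈ T, bondSpin σ e) :=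
    (measurable_spinProduct B).mul
      (Real.measurable_exp.comp ((Finset.measurable_sum _ fun e _ => measurable_bondSpin e).const_mul _))
  rw [isingExpect, integral_isingMeasure G Λ β 0 .plus hf, isingPartitionFunction_plus_eq G hG β,
    plusCurrentSumAvoid_eq]
  have hnum : ∑ τ : Λ → ℤˣ, isingWeight G Λ β 0 .plus τ *
      (spinProduct B (glue Λ τ .plus) * Real.exp (-β * ∑ e ∈ T, bondSpin (glue Λ τ .plus) e)) =
      (2 : ℝ) ^ #Λ * plusCurrentSum (G.deleteEdges ↑T) Λ β B := by
    rw [← sum_spinProduct_mul_prod_exp_glue_plus (G.deleteEdges ↑T) hB β]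
    refine Finset.sum_congr rfl fun τ _ => ?_
    rw [isingWeight_plus_eq_deleteEdges_mul G hG hT β τ, isingWeight_plus_eq_prod_exp _ hG' β τ]
    have : Real.exp (β * ∑ e ∈ T, bondSpin (glue Λ τ .plus) e) *
        Real.exp (-β * ∑ e ∈ T, bondSpin (glue Λ τ .plus) e) = 1 := by
      rw [← Real.exp_add]; simp
    calc (∏ e : (G.deleteEdges ↑T).edgeFinset, Real.exp (β * bondSpin (glue Λ τ .plus) (e : Sym2 V))) *
          Real.exp (β * ∑ e ∈ T, bondSpin (glue Λ τ .plus) e) *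
          (spinProduct B (glue Λ τ .plus) * Real.exp (-β * ∑ e ∈ T, bondSpin (glue Λ τ .plus) e))
        = spinProduct B (glue Λ τ .plus) *
            (∏ e : (G.deleteEdges ↑T).edgeFinset, Real.exp (β * bondSpin (glue Λ τ .plus) (e : Sym2 V))) *
            (Real.exp (β * ∑ e ∈ T, bondSpin (glue Λ τ .plus) e) *
              Real.exp (-β * ∑ e ∈ T, bondSpin (glue Λ τ .plus) e)) := by ring
      _ = spinProduct B (glue Λ τ .plus) *
            ∏ e : (G.deleteEdges ↑T).edgeFinset, Real.exp (β * bondSpin (glue Λ τ .plus) (e : Sym2 V)) := by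
          rw [this, mul_one]
  rw [hnum, mul_div_mul_left _ _ (by positivity)]

end General

/-! ### Sites covered an odd number of times -/

section Support

variable (d : ℕ)

/-- **Membership in `bondsSupport`**: a site belongs to `A(S) = Δ_{e ∈ S} e` iff it is covered by an
odd number of bonds of `S`. [folklore] -/
theorem mem_bondsSupport_iff (S : Finset (Sym2 (Site d))) (x : Site d) :
    x ∈ bondsSupport d S ↔ Odd #(S.filter fun e => x ∈ e) := by
  classical
  induction S using Finset.induction_on with
  | empty => simp [bondsSupport]
  | insert e S he ih =>
    have hfold : bondsSupport d (insert e S) = e.toFinset ∆ bondsSupport d S := by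
      rw [bondsSupport, Finset.fold_insert he]; rfl
    rw [hfold, Finset.mem_symmDiff, ih, Finset.filter_insert]
    by_cases hx : x ∈ e
    · rw [if_pos hx, Finset.card_insert_of_notMem (fun h => he (Finset.mem_filter.1 h).1), Nat.odd_add_one]
      have hxe : x ∈ e.toFinset := Sym2.mem_toFinset.2 hx
      constructor
      · rintro (⟨-, h⟩ | ⟨-, h⟩)
        · exact h
        · exact absurd hxe h
      · intro h
        exact Or.inl ⟨hxe, h⟩
    · rw [if_neg hx]
      have hxe : x ∉ e.toFinset := fun h => hx (Sym2.mem_toFinset.1 h)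
      constructor
      · rintro (⟨h, -⟩ | ⟨h, -⟩)
        · exact absurd h hxe
        · exact h
      · exact fun h => Or.inr ⟨h, hxe⟩

end Support

/-! ### The value cylinders of the box currents -/

section Box

variable (d : ℕ)

/-- **`P̂⁺_{Λ_L,β}[n = 𝟙_{S₁} on S]`**: the probability that the sourceless `+` current of the box `Λ_L`
takes the value `1` on the lattice bonds of `S₁` and `0` on those of `S ∖ S₁` (for `S₁ ⊆ S`). [cite: Raoufi2020, §2, Thm. 2] -/
def plusCurrentValProb (L : ℕ) (β : ℝ) (S S₁ : Finset (Sym2 (Site d))) : ℝ :=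
  plusCurrentSumVal (plusBoxGraph d L) (boxCore d L) β (boxBonds d L S) (boxBonds d L S₁) ∅ /
    plusCurrentSum (plusBoxGraph d L) (boxCore d L) β ∅

/-- **`P̂⁰_{Λ_L,β}[n = 𝟙_{S₁} on S]`**, the same for the sourceless free current of `Λ_L`. [cite: Raoufi2020, §2, Thm. 2] -/
def freeCurrentValProb (L : ℕ) (β : ℝ) (S S₁ : Finset (Sym2 (Site d))) : ℝ :=
  plusCurrentSumVal (freeBoxGraph d L) (boxCore d L) β (freeBoxBonds d L S) (freeBoxBonds d L S₁) ∅ /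
    plusCurrentSum (freeBoxGraph d L) (boxCore d L) β ∅

variable {d}

/-- Pulled-back bonds: for a graph `G` on `↥Λ_{L+1}`, the edges of `G` lying over the lattice bonds of
`T` (`boxBonds` for the plus box graph, `freeBoxBonds` for the free one). [folklore] -/
def liftedBonds {L : ℕ} (G : SimpleGraph (BoxVertex d L)) [DecidableRel G.Adj]
    (T : Finset (Sym2 (Site d))) : Finset (Sym2 (BoxVertex d L)) :=
  G.edgeFinset.filter fun e => Sym2.map Subtype.val e ∈ T

/-- `boxBonds` is `liftedBonds` of the plus box graph. [folklore] -/
theorem boxBonds_eq_liftedBonds (L : ℕ) (T : Finset (Sym2 (Site d))) :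
    boxBonds d L T = liftedBonds (plusBoxGraph d L) T := rfl

/-- `freeBoxBonds` is `liftedBonds` of the free box graph. [folklore] -/
theorem freeBoxBonds_eq_liftedBonds (L : ℕ) (T : Finset (Sym2 (Site d))) :
    freeBoxBonds d L T = liftedBonds (freeBoxGraph d L) T := rfl

/-- Lifted bonds of a subset. [folklore] -/
theorem liftedBonds_mono {L : ℕ} (G : SimpleGraph (BoxVertex d L)) [DecidableRel G.Adj]
    {T T' : Finset (Sym2 (Site d))} (h : T ⊆ T') : liftedBonds G T ⊆ liftedBonds G T' := by
  intro e he
  rw [liftedBonds, Finset.mem_filter] at he ⊢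
  exact ⟨he.1, h he.2⟩

/-- A vertex lies under a lifted bond iff its site lies under the bond. [folklore] -/
theorem mem_map_val_iff {L : ℕ} (v : BoxVertex d L) (e : Sym2 (BoxVertex d L)) :
    (v : Site d) ∈ Sym2.map Subtype.val e ↔ v ∈ e := by
  rw [Sym2.mem_map]
  constructor
  · rintro ⟨w, hw, hwv⟩
    rwa [← Subtype.val_injective hwv]
  · exact fun h => ⟨v, h, rfl⟩

/-- **The sources of the unit current are the odd-covered sites**: if every bond of `S₁ ⊆ S` is the
image of an edge of `G`, then `∂𝟙_{S₁}` (sources of `unitCurrent G (liftedBonds G S) (liftedBonds G S₁)`)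
is the set of vertices whose site is covered an odd number of times by `S₁`. [folklore] -/
theorem mem_sources_unitCurrent_iff {L : ℕ} (G : SimpleGraph (BoxVertex d L)) [DecidableRel G.Adj]
    {S S₁ : Finset (Sym2 (Site d))} (hS₁ : S₁ ⊆ S)
    (hsurj : ∀ s ∈ S₁, ∃ e ∈ G.edgeFinset, Sym2.map Subtype.val e = s) (v : BoxVertex d L) :
    v ∈ (unitCurrent G (liftedBonds G S) (liftedBonds G S₁)).sources ↔ (v : Site d) ∈ bondsSupport d S₁ := by
  rw [Current.mem_sources_iff, mem_bondsSupport_iff]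
  -- the degree of the unit current at `v` counts the lifted bonds of `S₁` at `v`
  have hdeg : (unitCurrent G (liftedBonds G S) (liftedBonds G S₁)).degree v =
      #(univ.filter fun e : G.edgeFinset => v ∈ (e : Sym2 (BoxVertex d L)) ∧ (e : Sym2 (BoxVertex d L)) ∈ liftedBonds G S₁) := by
    rw [Current.degree, Finset.card_filter]
    refine Finset.sum_congr rfl fun e _ => ?_
    simp only [unitCurrent]
    by_cases hv : v ∈ (e : Sym2 (BoxVertex d L))
    · rw [if_pos hv]
      by_cases h1 : (e : Sym2 (BoxVertex d L)) ∈ liftedBonds G S₁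
      · rw [if_pos ⟨liftedBonds_mono G hS₁ h1, h1⟩, if_pos ⟨hv, h1⟩]
      · rw [if_neg (fun h => h1 h.2), if_neg (fun h => h1 h.2)]
    · rw [if_neg hv, if_neg (fun h => hv h.1)]
  -- both counts agree with the number of bonds of `S₁` over the site of `v`
  have hcard : #(univ.filter fun e : G.edgeFinset => v ∈ (e : Sym2 (BoxVertex d L)) ∧ (e : Sym2 (BoxVertex d L)) ∈ liftedBonds G S₁) =
      #(S₁.filter fun s => (v : Site d) ∈ s) := by
    refine Finset.card_bij (fun e _ => Sym2.map Subtype.val (e : Sym2 (BoxVertex d L))) (fun e he => ?_)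
      (fun e₁ he₁ e₂ he₂ h => ?_) (fun s hs => ?_)
    · rw [Finset.mem_filter] at he ⊢
      rw [liftedBonds, Finset.mem_filter] at he
      exact ⟨he.2.2.2, (mem_map_val_iff v _).2 he.2.1⟩
    · exact Subtype.ext (Sym2.map.injective Subtype.val_injective h)
    · rw [Finset.mem_filter] at hs
      obtain ⟨e, he, hes⟩ := hsurj s hs.1
      refine ⟨⟨e, he⟩, ?_, hes⟩
      rw [Finset.mem_filter]
      refine ⟨Finset.mem_univ _, ?_, ?_⟩
      · rw [← mem_map_val_iff, hes]; exact hs.2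
      · rw [liftedBonds, Finset.mem_filter, hes]; exact ⟨he, hs.1⟩
  rw [hdeg, hcard]

/-- The number of lifted bonds carrying the value `1` is `|S₁|`. [folklore] -/
theorem card_filter_liftedBonds {L : ℕ} (G : SimpleGraph (BoxVertex d L)) [DecidableRel G.Adj]
    {S S₁ : Finset (Sym2 (Site d))} (hS₁ : S₁ ⊆ S)
    (hsurj : ∀ s ∈ S₁, ∃ e ∈ G.edgeFinset, Sym2.map Subtype.val e = s) :
    #(univ.filter fun e : G.edgeFinset =>
      (e : Sym2 (BoxVertex d L)) ∈ liftedBonds G S ∧ (e : Sym2 (BoxVertex d L)) ∈ liftedBonds G S₁) = #S₁ := by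
  refine Finset.card_bij (fun e _ => Sym2.map Subtype.val (e : Sym2 (BoxVertex d L))) (fun e he => ?_)
    (fun e₁ he₁ e₂ he₂ h => ?_) (fun s hs => ?_)
  · rw [Finset.mem_filter, liftedBonds, liftedBonds, Finset.mem_filter, Finset.mem_filter] at he
    exact he.2.2.2
  · exact Subtype.ext (Sym2.map.injective Subtype.val_injective h)
  · obtain ⟨e, he, hes⟩ := hsurj s hs
    refine ⟨⟨e, he⟩, ?_, hes⟩
    rw [Finset.mem_filter, liftedBonds, liftedBonds, Finset.mem_filter, Finset.mem_filter, hes]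
    exact ⟨Finset.mem_univ _, ⟨he, hS₁ hs⟩, ⟨he, hs⟩⟩

/-- Bonds inside `Λ_L` are images of edges of the plus box graph. [folklore] -/
theorem exists_plusBoxGraph_edge_of_mem_edgesIn {L : ℕ} {s : Sym2 (Site d)}
    (hs : s ∈ edgesIn (zdGraph d) (box d L)) :
    ∃ e ∈ (plusBoxGraph d L).edgeFinset, Sym2.map Subtype.val e = s := by
  rw [mem_edgesIn_iff] at hs
  obtain ⟨hsG, hin⟩ := hs
  induction s using Sym2.ind with
  | _ a b =>
    have hab : (zdGraph d).Adj a b := (SimpleGraph.mem_edgeSet _).1 hsG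
    have ha : a ∈ box d L := hin a (Sym2.mem_mk_left a b)
    have hb : b ∈ box d L := hin b (Sym2.mem_mk_right a b)
    refine ⟨s((⟨a, box_subset_box_succ d L ha⟩ : BoxVertex d L), ⟨b, box_subset_box_succ d L hb⟩), ?_, by simp⟩
    rw [SimpleGraph.mem_edgeFinset, SimpleGraph.mem_edgeSet]
    exact ⟨hab, Or.inl ha⟩

/-- Bonds inside `Λ_L` are images of edges of the free box graph. [folklore] -/
theorem exists_freeBoxGraph_edge_of_mem_edgesIn {L : ℕ} {s : Sym2 (Site d)}
    (hs : s ∈ edgesIn (zdGraph d) (box d L)) :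
    ∃ e ∈ (freeBoxGraph d L).edgeFinset, Sym2.map Subtype.val e = s := by
  rw [mem_edgesIn_iff] at hs
  obtain ⟨hsG, hin⟩ := hs
  induction s using Sym2.ind with
  | _ a b =>
    have hab : (zdGraph d).Adj a b := (SimpleGraph.mem_edgeSet _).1 hsG
    have ha : a ∈ box d L := hin a (Sym2.mem_mk_left a b)
    have hb : b ∈ box d L := hin b (Sym2.mem_mk_right a b)
    refine ⟨s((⟨a, box_subset_box_succ d L ha⟩ : BoxVertex d L), ⟨b, box_subset_box_succ d L hb⟩), ?_, by simp⟩
    rw [SimpleGraph.mem_edgeFinset, SimpleGraph.mem_edgeSet]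
    exact ⟨hab, ha, hb⟩

/-- The odd-covered sites of bonds inside `Λ_L` lie in `Λ_L`. [folklore] -/
theorem bondsSupport_subset_box {L : ℕ} {S₁ : Finset (Sym2 (Site d))}
    (hS₁ : S₁ ⊆ edgesIn (zdGraph d) (box d L)) : bondsSupport d S₁ ⊆ box d L := by
  intro x hx
  rw [mem_bondsSupport_iff] at hx
  obtain ⟨s, hs⟩ : (S₁.filter fun e => x ∈ e).Nonempty := by
    rw [← Finset.card_pos]; exact hx.pos
  rw [Finset.mem_filter] at hs
  exact (mem_edgesIn_iff.1 (hS₁ hs.1)).2 x hs.2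

/-- The preimage in `↥Λ_{L+1}` of a set of sites of `Λ_L`, mapped back, is the set. [folklore] -/
theorem map_filter_val_mem {L : ℕ} {A : Finset (Site d)} (hA : A ⊆ box d L) :
    (univ.filter fun v : BoxVertex d L => (v : Site d) ∈ A).map (boxEmb d L) = A := by
  ext x
  simp only [Finset.mem_map, Finset.mem_filter, Finset.mem_univ, true_and, boxEmb_apply]
  constructor
  · rintro ⟨v, hv, rfl⟩; exact hv
  · intro hx; exact ⟨⟨x, box_subset_box_succ d L (hA hx)⟩, hx, rfl⟩

/-- **The `+` value cylinder as an Ising expectation**: for `S₁ ⊆ S ⊆ ℰ_{Λ_L}` and every real `β`,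
`P̂⁺_{Λ_L,β}[n = 𝟙_{S₁} on S] = β^{|S₁|} ⟨σ_{A(S₁)} e^{-βK_S}⟩⁺_{Λ_L;β,0}`, where `A(S₁) = ∂𝟙_{S₁}` is
the set of sites covered an odd number of times by `S₁` (ADS15 (2.13)–(2.14) one step further:
`n = 𝟙_{S₁} + m`, `w(n) = β^{|S₁|} w(m)`, `∂m = ∂𝟙_{S₁}`, and the sourced avoidance sum is the
`+` expectation of `σ_{∂𝟙_{S₁}} e^{-βK_S}`). [cite: AizenmanDuminilCopinSidoraviciusCMP2015, §2.2, eqs. (2.13)–(2.14)] -/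
theorem plusCurrentValProb_eq_isingExpect (L : ℕ) (β : ℝ) {S S₁ : Finset (Sym2 (Site d))}
    (hS₁ : S₁ ⊆ S) (hS : S ⊆ edgesIn (zdGraph d) (box d L)) :
    plusCurrentValProb d L β S S₁ = β ^ #S₁ *
      isingExpect (zdGraph d) (box d L) β 0 .plus
        (fun σ => spinProduct (bondsSupport d S₁) σ * expNegBonds d β S σ) := by
  have hsurj : ∀ s ∈ S₁, ∃ e ∈ (plusBoxGraph d L).edgeFinset, Sym2.map Subtype.val e = s := fun s hs =>
    exists_plusBoxGraph_edge_of_mem_edgesIn (hS (hS₁ hs))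
  have hT : boxBonds d L S ⊆ (plusBoxGraph d L).edgeFinset := Finset.filter_subset _ _
  set A' : Finset (BoxVertex d L) := univ.filter fun v => (v : Site d) ∈ bondsSupport d S₁ with hA'
  have hsrc : (unitCurrent (plusBoxGraph d L) (boxBonds d L S) (boxBonds d L S₁)).sources = A' := by
    ext v
    rw [boxBonds_eq_liftedBonds, boxBonds_eq_liftedBonds, mem_sources_unitCurrent_iff (plusBoxGraph d L) hS₁ hsurj v,
      hA', Finset.mem_filter]
    simp
  have hA'core : A' ⊆ boxCore d L := by
    intro v hv
    rw [hA', Finset.mem_filter] at hv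
    exact (mem_boxCore d).2 (bondsSupport_subset_box (hS₁.trans hS) hv.2)
  have hA'map : A'.map (boxEmb d L) = bondsSupport d S₁ := map_filter_val_mem (bondsSupport_subset_box (hS₁.trans hS))
  -- the observable transported to the box graph
  have hST : S ⊆ edgesTouching (zdGraph d) (box d L) := hS.trans (edgesIn_subset_edgesTouching _)
  have hadj : ∀ x ∈ boxCore d L, ∀ y : BoxVertex d L,
      ((zdGraph d).Adj (boxEmb d L x) (boxEmb d L y) ↔ (plusBoxGraph d L).Adj x y) := by
    intro x hx y
    rw [plusBoxGraph_adj, boxEmb_apply, boxEmb_apply]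
    exact ⟨fun h => ⟨h, Or.inl ((mem_boxCore d).1 hx)⟩, fun h => h.1⟩
  have hnb : ∀ x ∈ boxCore d L, ∀ y' : Site d, (zdGraph d).Adj (boxEmb d L x) y' →
      ∃ y : BoxVertex d L, boxEmb d L y = y' := by
    intro x hx y' hxy
    exact ⟨⟨y', mem_box_succ_of_zdGraph_adj d ((mem_boxCore d).1 hx) hxy⟩, rfl⟩
  have hmeas : Measurable fun σ : SpinConfig (Site d) => spinProduct (bondsSupport d S₁) σ * expNegBonds d β S σ :=
    (measurable_spinProduct _).mul (measurable_expNegBonds d β S)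
  have htrans := isingExpect_plus_map (G := plusBoxGraph d L) (boxEmb d L) hadj hnb β 0 hmeas
  rw [map_boxCore d L] at htrans
  have hf : (fun σ : SpinConfig (BoxVertex d L) =>
      spinProduct (bondsSupport d S₁) (SpinConfig.extendAlong (boxEmb d L) σ) *
        expNegBonds d β S (SpinConfig.extendAlong (boxEmb d L) σ)) =
      fun σ => spinProduct A' σ * Real.exp (-β * ∑ e ∈ boxBonds d L S, bondSpin σ e) := by
    funext σ
    rw [← hA'map, spinProduct_map_extendAlong, expNegBonds, ← sum_boxBonds_eq d hST]
    congr 3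
    exact Finset.sum_congr rfl fun e' _ => bondSpin_extendAlong_map (boxEmb d L) σ e'
  rw [htrans, hf, plusCurrentValProb, plusCurrentSumVal_eq, hsrc, mul_div_assoc, Finset.inter_eq_left.2 hA'core,
    show (∅ : Finset (BoxVertex d L)) ∆ A' = A' from bot_symmDiff A',
    plusCurrentSumAvoid_div_eq_isingExpect_spinProduct (plusBoxGraph d L) (edgesTouching_plusBoxGraph d L)
      hT β hA'core,
    boxBonds_eq_liftedBonds, boxBonds_eq_liftedBonds, card_filter_liftedBonds (plusBoxGraph d L) hS₁ hsurj]

/-- **The free value cylinder as an Ising expectation**: for `S₁ ⊆ S ⊆ ℰ_{Λ_L}` and every real `β`,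
`P̂⁰_{Λ_L,β}[n = 𝟙_{S₁} on S] = β^{|S₁|} ⟨σ_{A(S₁)} e^{-βK_S}⟩⁰_{Λ_L;β,0}`. [cite: AizenmanDuminilCopinSidoraviciusCMP2015, §2.2, eqs. (2.13)–(2.14)] -/
theorem freeCurrentValProb_eq_isingExpect (L : ℕ) (β : ℝ) {S S₁ : Finset (Sym2 (Site d))}
    (hS₁ : S₁ ⊆ S) (hS : S ⊆ edgesIn (zdGraph d) (box d L)) :
    freeCurrentValProb d L β S S₁ = β ^ #S₁ *
      isingExpect (zdGraph d) (box d L) β 0 .free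
        (fun σ => spinProduct (bondsSupport d S₁) σ * expNegBonds d β S σ) := by
  have hsurj : ∀ s ∈ S₁, ∃ e ∈ (freeBoxGraph d L).edgeFinset, Sym2.map Subtype.val e = s := fun s hs =>
    exists_freeBoxGraph_edge_of_mem_edgesIn (hS (hS₁ hs))
  have hT : freeBoxBonds d L S ⊆ (freeBoxGraph d L).edgeFinset := Finset.filter_subset _ _
  set A' : Finset (BoxVertex d L) := univ.filter fun v => (v : Site d) ∈ bondsSupport d S₁ with hA'
  have hsrc : (unitCurrent (freeBoxGraph d L) (freeBoxBonds d L S) (freeBoxBonds d L S₁)).sources = A' := by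
    ext v
    rw [freeBoxBonds_eq_liftedBonds, freeBoxBonds_eq_liftedBonds,
      mem_sources_unitCurrent_iff (freeBoxGraph d L) hS₁ hsurj v, hA', Finset.mem_filter]
    simp
  have hA'core : A' ⊆ boxCore d L := by
    intro v hv
    rw [hA', Finset.mem_filter] at hv
    exact (mem_boxCore d).2 (bondsSupport_subset_box (hS₁.trans hS) hv.2)
  have hA'map : A'.map (boxEmb d L) = bondsSupport d S₁ := map_filter_val_mem (bondsSupport_subset_box (hS₁.trans hS))
  have hadj : ∀ x ∈ boxCore d L, ∀ y ∈ boxCore d L,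
      ((zdGraph d).Adj (boxEmb d L x) (boxEmb d L y) ↔ (freeBoxGraph d L).Adj x y) := by
    intro x hx y hy
    rw [freeBoxGraph_adj, boxEmb_apply, boxEmb_apply]
    exact ⟨fun h => ⟨h, (mem_boxCore d).1 hx, (mem_boxCore d).1 hy⟩, fun h => h.1⟩
  have hmeas : Measurable fun σ : SpinConfig (Site d) => spinProduct (bondsSupport d S₁) σ * expNegBonds d β S σ :=
    (measurable_spinProduct _).mul (measurable_expNegBonds d β S)
  have htrans := isingExpect_free_map (G := freeBoxGraph d L) (boxEmb d L) hadj β 0 hmeas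
  rw [map_boxCore d L] at htrans
  have hf : (fun σ : SpinConfig (BoxVertex d L) =>
      spinProduct (bondsSupport d S₁) (SpinConfig.extendAlong (boxEmb d L) σ) *
        expNegBonds d β S (SpinConfig.extendAlong (boxEmb d L) σ)) =
      fun σ => spinProduct A' σ * Real.exp (-β * ∑ e ∈ freeBoxBonds d L S, bondSpin σ e) := by
    funext σ
    rw [← hA'map, spinProduct_map_extendAlong, expNegBonds, ← sum_freeBoxBonds_eq d hS]
    congr 3
    exact Finset.sum_congr rfl fun e' _ => bondSpin_extendAlong_map (boxEmb d L) σ e'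
  rw [htrans, hf, isingExpect_free_eq_plus_of_edgesIn_eq _ (edgesIn_freeBoxGraph d L), freeCurrentValProb,
    plusCurrentSumVal_eq, hsrc, mul_div_assoc,
    Finset.inter_eq_left.2 hA'core, show (∅ : Finset (BoxVertex d L)) ∆ A' = A' from bot_symmDiff A',
    plusCurrentSumAvoid_div_eq_isingExpect_spinProduct (freeBoxGraph d L) (edgesTouching_freeBoxGraph d L)
      hT β hA'core,
    freeBoxBonds_eq_liftedBonds, freeBoxBonds_eq_liftedBonds, card_filter_liftedBonds (freeBoxGraph d L) hS₁ hsurj]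

/-! ### Expansion in correlations and the limit `L → ∞` -/

/-- **`σ_A e^{-βK_T}` as a finite combination of spin products**:
`⟨σ_A e^{-βK_T}⟩ = ∑_{R ⊆ T} cosh(β)^{|T|} (-sinh β)^{|R|}/cosh(β)^{|R|} ⟨σ_{A ∆ A(R)}⟩` for every
finite-volume Gibbs expectation (any boundary condition, any field). [cite: AizenmanDuminilCopinSidoraviciusCMP2015, §2.2, eq. (2.14)] -/
theorem isingExpect_spinProduct_expNegBonds_eq_sum (Λ : Finset (Site d)) (β h : ℝ)
    (bc : BoundaryCondition (Site d)) (A : Finset (Site d)) {T : Finset (Sym2 (Site d))}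
    (hT : ∀ e ∈ T, ¬e.IsDiag) :
    isingExpect (zdGraph d) Λ β h bc (fun σ => spinProduct A σ * expNegBonds d β T σ) =
      ∑ R ∈ T.powerset, Real.cosh β ^ #T * (-Real.sinh β) ^ #R / Real.cosh β ^ #R *
        isingCorr (zdGraph d) Λ β h bc (A ∆ bondsSupport d R) := by
  have hfun : (fun σ => spinProduct A σ * expNegBonds d β T σ) = fun σ => ∑ R ∈ T.powerset,
      Real.cosh β ^ #T * (-Real.sinh β) ^ #R / Real.cosh β ^ #R * spinProduct (A ∆ bondsSupport d R) σ := by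
    funext σ
    rw [expNegBonds_eq_sum d β hT, Finset.mul_sum]
    refine Finset.sum_congr rfl fun R _ => ?_
    rw [← spinProduct_mul_spinProduct]
    ring
  rw [hfun, isingExpect_finset_sum' _ _ _ _ β _ _ fun R => (measurable_spinProduct _).const_mul _]
  refine Finset.sum_congr rfl fun R _ => ?_
  rw [isingExpect_const_mul' _ _ _ _ β _ (measurable_spinProduct _)]
  rfl

variable (d)

/-- The limit `lim_L P̂⁺_{Λ_L,β}[n = 𝟙_{S₁} on S] = β^{|S₁|} ∑_{R ⊆ S} c_R ⟨σ_{A(S₁) ∆ A(R)}⟩⁺_β`. [cite: Raoufi2020, §2, Thm. 2] -/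
def plusCurrentValLimit (β : ℝ) (S S₁ : Finset (Sym2 (Site d))) : ℝ :=
  β ^ #S₁ * ∑ R ∈ S.powerset, Real.cosh β ^ #S * (-Real.sinh β) ^ #R / Real.cosh β ^ #R *
    plusCorr d β 0 (bondsSupport d S₁ ∆ bondsSupport d R)

/-- The limit `lim_L P̂⁰_{Λ_L,β}[n = 𝟙_{S₁} on S] = β^{|S₁|} ∑_{R ⊆ S} c_R ⟨σ_{A(S₁) ∆ A(R)}⟩⁰_β`. [cite: Raoufi2020, §2, Thm. 2] -/
def freeCurrentValLimit (β : ℝ) (S S₁ : Finset (Sym2 (Site d))) : ℝ :=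
  β ^ #S₁ * ∑ R ∈ S.powerset, Real.cosh β ^ #S * (-Real.sinh β) ^ #R / Real.cosh β ^ #R *
    freeCorr d β 0 (bondsSupport d S₁ ∆ bondsSupport d R)

/-- **Convergence of the `+` value cylinders** (Raoufi 2020, Thm. 2 / ADS15 Thm. 2.3 (R1) at the level
of values): for `β ≥ 0` and finite sets `S₁ ⊆ S` of lattice bonds,
`P̂⁺_{Λ_L,β}[n = 𝟙_{S₁} on S] → β^{|S₁|} ∑_{R ⊆ S} c_R ⟨σ_{A(S₁) ∆ A(R)}⟩⁺_β`, by the existence of the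
plus state on spin products (`hasBoxLimit_isingCorr_plus_holds`). [cite: Raoufi2020, §2, Thm. 2] -/
theorem tendsto_plusCurrentValProb {β : ℝ} (hβ : 0 ≤ β) {S S₁ : Finset (Sym2 (Site d))}
    (hS₁ : S₁ ⊆ S) (hS : ↑S ⊆ (zdGraph d).edgeSet) :
    Tendsto (fun L : ℕ => plusCurrentValProb d L β S S₁) atTop (𝓝 (plusCurrentValLimit d β S S₁)) := by
  unfold plusCurrentValLimit
  have hdiag : ∀ e ∈ S, ¬e.IsDiag := fun e he => not_isDiag_of_mem_edgeSet d (hS he)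
  have hlim : Tendsto (fun L : ℕ => β ^ #S₁ * isingExpect (zdGraph d) (box d L) β 0 .plus
      (fun σ => spinProduct (bondsSupport d S₁) σ * expNegBonds d β S σ)) atTop
      (𝓝 (β ^ #S₁ * ∑ R ∈ S.powerset, Real.cosh β ^ #S * (-Real.sinh β) ^ #R / Real.cosh β ^ #R *
        plusCorr d β 0 (bondsSupport d S₁ ∆ bondsSupport d R))) := by
    simp_rw [isingExpect_spinProduct_expNegBonds_eq_sum _ β 0 .plus _ hdiag]
    exact (tendsto_finsetSum _ fun R _ =>
      (hasBoxLimit_isingCorr_plus_holds hβ le_rfl (bondsSupport d S₁ ∆ bondsSupport d R)).const_mul _).const_mul _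
  refine hlim.congr' ?_
  filter_upwards [eventually_subset_edgesIn d hS] with L hL
  exact (plusCurrentValProb_eq_isingExpect L β hS₁ hL).symm

/-- **Convergence of the free value cylinders**: for `β ≥ 0` and finite `S₁ ⊆ S` of lattice bonds,
`P̂⁰_{Λ_L,β}[n = 𝟙_{S₁} on S] → β^{|S₁|} ∑_{R ⊆ S} c_R ⟨σ_{A(S₁) ∆ A(R)}⟩⁰_β`, by the existence of the
free state on spin products (`hasBoxLimit_isingCorr_free_holds`). [cite: Raoufi2020, §2, Thm. 2] -/
theorem tendsto_freeCurrentValProb {β : ℝ} (hβ : 0 ≤ β) {S S₁ : Finset (Sym2 (Site d))}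
    (hS₁ : S₁ ⊆ S) (hS : ↑S ⊆ (zdGraph d).edgeSet) :
    Tendsto (fun L : ℕ => freeCurrentValProb d L β S S₁) atTop (𝓝 (freeCurrentValLimit d β S S₁)) := by
  unfold freeCurrentValLimit
  have hdiag : ∀ e ∈ S, ¬e.IsDiag := fun e he => not_isDiag_of_mem_edgeSet d (hS he)
  have hlim : Tendsto (fun L : ℕ => β ^ #S₁ * isingExpect (zdGraph d) (box d L) β 0 .free
      (fun σ => spinProduct (bondsSupport d S₁) σ * expNegBonds d β S σ)) atTop
      (𝓝 (β ^ #S₁ * ∑ R ∈ S.powerset, Real.cosh β ^ #S * (-Real.sinh β) ^ #R / Real.cosh β ^ #R *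
        freeCorr d β 0 (bondsSupport d S₁ ∆ bondsSupport d R))) := by
    simp_rw [isingExpect_spinProduct_expNegBonds_eq_sum _ β 0 .free _ hdiag]
    exact (tendsto_finsetSum _ fun R _ =>
      (hasBoxLimit_isingCorr_free_holds hβ le_rfl (bondsSupport d S₁ ∆ bondsSupport d R)).const_mul _).const_mul _
  refine hlim.congr' ?_
  filter_upwards [eventually_subset_edgesIn d hS] with L hL
  exact (freeCurrentValProb_eq_isingExpect L β hS₁ hL).symm

/-- The value cylinder probabilities are nonnegative (`β ≥ 0`). [folklore] -/
theorem plusCurrentValProb_nonneg (L : ℕ) {β : ℝ} (hβ : 0 ≤ β) (S S₁ : Finset (Sym2 (Site d))) :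
    0 ≤ plusCurrentValProb d L β S S₁ :=
  div_nonneg (plusCurrentSumVal_nonneg _ _ hβ _ _ _) (plusCurrentSum_nonneg _ _ hβ _)

/-- The free value cylinder probabilities are nonnegative (`β ≥ 0`). [folklore] -/
theorem freeCurrentValProb_nonneg (L : ℕ) {β : ℝ} (hβ : 0 ≤ β) (S S₁ : Finset (Sym2 (Site d))) :
    0 ≤ freeCurrentValProb d L β S S₁ :=
  div_nonneg (plusCurrentSumVal_nonneg _ _ hβ _ _ _) (plusCurrentSum_nonneg _ _ hβ _)

/-- Hence the limits are nonnegative. [folklore] -/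
theorem plusCurrentValLimit_nonneg {β : ℝ} (hβ : 0 ≤ β) {S S₁ : Finset (Sym2 (Site d))}
    (hS₁ : S₁ ⊆ S) (hS : ↑S ⊆ (zdGraph d).edgeSet) : 0 ≤ plusCurrentValLimit d β S S₁ :=
  ge_of_tendsto' (tendsto_plusCurrentValProb d hβ hS₁ hS) fun L => plusCurrentValProb_nonneg d L hβ S S₁

/-- Hence the free limits are nonnegative. [folklore] -/
theorem freeCurrentValLimit_nonneg {β : ℝ} (hβ : 0 ≤ β) {S S₁ : Finset (Sym2 (Site d))}
    (hS₁ : S₁ ⊆ S) (hS : ↑S ⊆ (zdGraph d).edgeSet) : 0 ≤ freeCurrentValLimit d β S S₁ :=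
  ge_of_tendsto' (tendsto_freeCurrentValProb d hβ hS₁ hS) fun L => freeCurrentValProb_nonneg d L hβ S S₁

end Box

end Literature.Probability.LatticeModels
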